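import Literature.MathematicalPhysics.QuantumFieldTheory.Balaban1983to89.B6Cor28EntriesKLevelV1
import Literature.MathematicalPhysics.QuantumFieldTheory.Balaban1983to89.B6PadLevelV1
import HarnessLib

/-!
# Route `UnitScaleTilt`, crux K1 child «MinimiserStabilityRegPr» (stmt-QuantumFields-19200), v8 pillar **P2 `stub_flatOpsCubeSeq`** — THE PORT BRIDGE, file 4:
# **[Balaban1984PropagatorsII] COROLLARY 2.8 (2.151)₁,₂ AT k LEVELS FOR EVERY TORUS FAMILY, EVERY ODD `L ≥ 5`, `k ≥ 1`, WITHOUT THE PLACEMENT HYPOTHESIS**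
# — lit-balaban's hypothesis-free `B6Cor28EntriesKLevelV1.cor28_kLevel_H_DH` (binders: `k ≥ 2`, `P′ ≥ 5`, every cube of the cover PLACED in the canonical chart —
# dischargeable as stated only at `L = 5`, `B6CubeWindowV1.placed_all_cubes`) applied to p38's PADDED family `B6PadLevelV1.padT D` (one empty top level: every cube
# lies below the top, `placed_pad`; `k + 1 ≥ 2`) and transported back along `B6PadLevelV1.sameOm_domT_pad` (same `Ω_j`, same `Δ_a`, `G`, `Q`, `Q*`, hence the same
# `(QGQ*)⁻¹` and `H = GQ*(QGQ*)⁻¹`; same blocks, same carrier blocks `β`, same distance (2.46))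

Cell `ym3-torus` (HUMAN RULING D-0037, YM ladder rung R3), seat `ym3-torus-p1` gen 17.  `--supports stmt-QuantumFields-19200 --as helper`; count-neutral; def-free.

WHY (P2 side).  The P2 text `FlatCubeOpsText.FlatOpsAdmAtMS` quantifies over every odd `L > 1` and every height `k = K − n ≥ 1`; the port's k-level rows carry `4 ≤ ℓ`
(`L ≥ 5`), `2 ≤ k` and the chart-placement of the top cubes.  Padding (print p. 224: *«we admit the case when some domains Ω_j are equal to T_η»* — and empty top
domains change nothing) removes the last two at once; `L = 3` stays a named sub-gap (G-F3′-L0∕L3).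

WHAT IS PROVED (sorry-free; axioms standard; no definition), for `SameOm`-related V1 data and for the padded torus family:
* §1 transport along `B6PadLevelV1.SameOm h`: `UI_single` (coordinate vectors), `qgqE_UI`, **`EE_UI`** (`(QGQ*)⁻¹` agrees: `E₂(Uω) = U(E₁ω)`), **`H_UI`**
  (`(GQ*(QGQ*)⁻¹)₂(Uω) = (GQ*(QGQ*)⁻¹)₁ω` on the fine bonds), `onFun_H_single` (the bond-function readings against `Pi.single` agree);
* §2 for `padT`: `base_pad`, **`beta_pad`** (`β` of the padded family is the relabelled `β`), `len_pad`;
* §3 **`cor28_kLevel_H_DH_pad`** = `cor28_kLevel_H_DH` with the binder list `(1 ≤ k, k + 1 ≤ m + K, P′ = L·P″, P″ ≥ 5)` in place of `(2 ≤ k, P′ ≥ 5, Placed)`, SAME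
  constants `σ₁, δ₅, C, M₂, N₁` and the same two conclusions for the genuine `H` of `domT hN D hk`.
HONEST SCOPE: bookkeeping over landed certificates (r03's Cor. 2.8 chain, p38's padding); inherits their standing hypotheses `M_h = Lᵃ ≥ 8`, `R ≥ 2L²`, `4 ≤ ℓ`, the (2.16)
band, `M₂ ≤ L·M_h`, `N₁ + 1 ≤ R·L·M_h`; the Hölder entry of (2.151) is not touched.  NOT a claim about the mass gap.

References: T. Bałaban, CMP **96** (1984) 223–250 [Balaban1984PropagatorsII] (2.1)–(2.4) p.224, (2.35) p.228, (2.46) p.231, Cor. 2.8 (2.150)–(2.151) p.249.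
-/

set_option autoImplicit false

noncomputable section

open scoped BigOperators InnerProductSpace

namespace Summit.QuantumFields.YangMills.Theorems.FlatPortCor28Pad

open Literature.MathematicalPhysics.QuantumFieldTheory.Balaban1983to89
open Literature.MathematicalPhysics.QuantumFieldTheory.BalabanImbrieJaffe1984to88.BIJ85AxialPropagator411 (BondSpace)
open B5Eq118OneStroke (iterBlockOf)
open B6MultiLevelBoxOperator (N0)
open B6MultiLevelTorusOperator (TDomains)
open B6Geom246MultiLevelBox (bset blkOf)
open B6Geom246MultiLevelTorus (geomT)
open B6GlobalChartV1 (PV toBox blkV1 domT)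
open B6Ineq2142KLevelV1 (lvl β base baseSite iterBlockOf_baseSite blkOf_eq_beta)
open B6Ineq2133TwoScaleV1 (onFun onFun_apply)
open B6GradLegKLevelV1 (DV)
open B6SectADomainsV1 (Domains)
open B6SectAOperatorsV1 (BondIdx BondIdxSpace QE QsE)
open B6SectAVectorModelV1 (GE EE qgqE qgqE_def comp_EE EE_comp)
open B6CubeWindowV1 (Placed GlobalBand)
open B6Cover236MultiLevelBlocks (cubes)
open B6PadLevelV1 (SameOm padT padT_lev hN_pad placed_pad sameOm_domT_pad eT eT_blkV1 dist_eT globalBand_pad)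
open B6Cor28EntriesKLevelV1 (cor28_kLevel_H_DH)

/-! ## §1 Transport of `(QGQ*)⁻¹` and `H` along `SameOm` -/

section Transport

variable {P : Params} {D₁ D₂ : Domains P} (h : SameOm D₁ D₂)

/-- components of the reindexing `U`: `(Uω)(i) = ω(idxB i)` (plumbing; private — the statement shape coincides with `B6TranslateV1.IsTr.UI_apply`). [folklore] -/
private theorem UI_apply (ω : BondIdxSpace D₁) (i : BondIdx D₂) : h.UI ω i = ω (h.idxB i) := rfl

/-- the coordinate vector of `idxB⁻¹ c` is the reindexed coordinate vector of `c`. [folklore] -/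
theorem UI_single (c : BondIdx D₁) : EuclideanSpace.single (h.idxB.symm c) (1 : ℝ) = h.UI (EuclideanSpace.single c (1 : ℝ)) := by
  ext i
  rw [UI_apply]
  show (Pi.single (h.idxB.symm c) (1 : ℝ) : BondIdx D₂ → ℝ) i = (Pi.single c (1 : ℝ) : BondIdx D₁ → ℝ) (h.idxB i)
  by_cases hi : i = h.idxB.symm c
  · subst hi; simp
  · have : h.idxB i ≠ c := fun hc => hi (by rw [← hc, Equiv.symm_apply_apply])
    rw [Pi.single_eq_of_ne hi, Pi.single_eq_of_ne this]

variable {c : ℝ} (hc : c ≠ 0) {w : BondIdx D₁ → ℝ} (hw : ∀ i, 0 < w i) (hw' : ∀ i, 0 < (w ∘ h.idxB) i)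

/-- **`QGQ*` AGREES**: `(QGQ*)₂(Uω) = U((QGQ*)₁ω)`. [cite: Balaban1984PropagatorsII, (2.35) p.228] -/
theorem qgqE_UI (x : BondIdxSpace D₁) : qgqE D₂ hc hw' (h.UI x) = h.UI (qgqE D₁ hc hw x) := by
  rw [qgqE_def, qgqE_def]
  simp only [LinearMap.comp_apply]
  rw [h.QsE_UI, h.GE_eq hc hw hw', h.QE_apply_eq]

/-- **`(QGQ*)⁻¹` AGREES**: `E₂(Uω) = U(E₁ω)`. [cite: Balaban1984PropagatorsII, (2.35) p.228] -/
theorem EE_UI (ω : BondIdxSpace D₁) : EE D₂ hc hw' (h.UI ω) = h.UI (EE D₁ hc hw ω) := by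
  have h1 : qgqE D₁ hc hw (EE D₁ hc hw ω) = ω := by
    have := LinearMap.congr_fun (comp_EE D₁ hc hw) ω
    rwa [← qgqE_def] at this
  have h2 : h.UI ω = qgqE D₂ hc hw' (h.UI (EE D₁ hc hw ω)) := by rw [qgqE_UI h hc hw hw', h1]
  rw [h2]
  have := LinearMap.congr_fun (EE_comp D₂ hc hw') (h.UI (EE D₁ hc hw ω))
  rwa [← qgqE_def] at this

/-- **`H = GQ*(QGQ*)⁻¹` AGREES** on the fine bonds: `H₂(Uω) = H₁ω`. [cite: Balaban1984PropagatorsII, (2.35) p.228] -/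
theorem H_UI (ω : BondIdxSpace D₁) :
    (GE D₂ hc hw' ∘ₗ QsE D₂ ∘ₗ EE D₂ hc hw') (h.UI ω) = (GE D₁ hc hw ∘ₗ QsE D₁ ∘ₗ EE D₁ hc hw) ω := by
  simp only [LinearMap.comp_apply]
  rw [EE_UI h hc hw hw', h.QsE_UI, h.GE_eq hc hw hw']

/-- the bond-function readings against the coordinate data agree: `onFun H₂ (Pi.single (idxB⁻¹ c) 1) = onFun H₁ (Pi.single c 1)`. [cite: Balaban1984PropagatorsII, (2.150) p.249] -/
theorem onFun_H_single (cI : BondIdx D₁) :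
    onFun (GE D₂ hc hw' ∘ₗ QsE D₂ ∘ₗ EE D₂ hc hw') (Pi.single (h.idxB.symm cI) 1) = onFun (GE D₁ hc hw ∘ₗ QsE D₁ ∘ₗ EE D₁ hc hw) (Pi.single cI 1) := by
  funext f
  rw [onFun_apply, onFun_apply]
  have e2 : WithLp.toLp 2 (Pi.single (h.idxB.symm cI) (1 : ℝ)) = EuclideanSpace.single (h.idxB.symm cI) (1 : ℝ) := rfl
  have e1 : WithLp.toLp 2 (Pi.single cI (1 : ℝ)) = EuclideanSpace.single cI (1 : ℝ) := rfl
  rw [e2, e1, UI_single, H_UI h hc hw hw']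

end Transport

/-! ## §2 The carrier blocks `β` and the block lengths of the padded family -/

section PadGeom

variable {d ℓ m K : ℕ} {hd : 1 ≤ d + 1} {hL : Odd (ℓ + 1) ∧ 1 < ℓ + 1}
variable {Mh k R : ℕ} {P' P'' : Fin (d + 1) → ℕ}
variable (hN : ∀ μ, N0 ℓ Mh k P' μ = (PV d ℓ m K hd hL).sitesPerDir 0) (D : TDomains d ℓ Mh k P' R) (hk : k ≤ m + K)
variable (hLP : ∀ μ, P' μ = (ℓ + 1) * P'' μ) (hk' : k + 1 ≤ m + K)

/-- the base end-point of an index bond is the same in the padded family (same `Ω_j`). [cite: Balaban1984PropagatorsII, (2.3) p.224, bookkeeping] -/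
theorem base_pad (cI : BondIdx (domT hN D hk)) :
    base (hN_pad hN hLP) (padT D hLP) hk' ((sameOm_domT_pad hN D hk hLP hk').idxB.symm cI) = base hN D hk cI := by
  set hS := sameOm_domT_pad hN D hk hLP hk'
  unfold base
  by_cases hm : cI.1.2.src ∈ (domT hN D hk).Om (lvl hN D hk cI)
  · have hm' : (hS.idxB.symm cI).1.2.src ∈ (domT (hN_pad hN hLP) (padT D hLP) hk').Om (lvl (hN_pad hN hLP) (padT D hLP) hk' (hS.idxB.symm cI)) :=
      (hS.mem_Om _ _).2 hm
    rw [if_pos hm', if_pos hm]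
    rfl
  · have hm' : (hS.idxB.symm cI).1.2.src ∉ (domT (hN_pad hN hLP) (padT D hLP) hk').Om (lvl (hN_pad hN hLP) (padT D hLP) hk' (hS.idxB.symm cI)) :=
      fun h' => hm ((hS.mem_Om _ _).1 h')
    rw [if_neg hm', if_neg hm]
    rfl

/-- **THE CARRIER BLOCK `β` OF THE PADDED FAMILY IS THE RELABELLED CARRIER BLOCK** (both are the block of `𝔅` containing `B^j(base c)`).
[cite: Balaban1984PropagatorsII, (2.45) p.231] -/
theorem beta_pad (hk1 : 1 ≤ k) (cI : BondIdx (domT hN D hk)) :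
    β (hN_pad hN hLP) (padT D hLP) hk' ((sameOm_domT_pad hN D hk hLP hk').idxB.symm cI) = eT D hLP (β hN D hk cI) := by
  set hS := sameOm_domT_pad hN D hk hLP hk'
  set x : Site (PV d ℓ m K hd hL) 0 := baseSite (hN_pad hN hLP) (padT D hLP) hk' (hS.idxB.symm cI) with hx
  -- `x` lies over `base c`
  have hxb : iterBlockOf (lvl hN D hk cI) x = base hN D hk cI := by
    have h1 := iterBlockOf_baseSite (hN_pad hN hLP) (padT D hLP) hk' (hS.idxB.symm cI)
    rw [base_pad hN D hk hLP hk'] at h1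
    exact h1
  -- in `D`, the block of `x` is `β c`
  have hD : blkOf D.toDomains (toBox hN x) = β hN D hk cI := blkOf_eq_beta hN D hk hk1 cI hxb
  -- in the padded family, `β` is the block of `x` by definition; the block maps agree (`eT_blkV1` at the bond `⟨x, 0⟩`)
  have hpad : β (hN_pad hN hLP) (padT D hLP) hk' (hS.idxB.symm cI) = blkV1 (hN_pad hN hLP) (padT D hLP) ⟨x, ⟨0, hd⟩⟩ := rfl
  rw [hpad, ← eT_blkV1 D hLP hN]
  show eT D hLP (blkOf D.toDomains (toBox hN x)) = _
  rw [hD]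

/-- the block lengths are unchanged (same level, same `L`, `η = 1`). [cite: Balaban1984PropagatorsII, (2.46) p.231, bookkeeping] -/
theorem len_pad (f : PBond (PV d ℓ m K hd hL) 0) : (geomT (padT D hLP)).len (blkV1 (hN_pad hN hLP) (padT D hLP) f) = (geomT D).len (blkV1 hN D f) := rfl

omit hk' in
/-- the block length of a relabelled block is unchanged. [cite: Balaban1984PropagatorsII, (2.46) p.231, bookkeeping] -/
theorem len_eT (y : ↥(bset D.toDomains)) : (geomT (padT D hLP)).len (eT D hLP y) = (geomT D).len y := rfl

end PadGeom

/-! ## §3 Corollary 2.8 (2.151)₁,₂ at k levels without the placement hypothesis, `k ≥ 1` -/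

section Main

variable {d ℓ : ℕ}

/-- **[B6] COROLLARY 2.8 (2.151)₁,₂ AT k LEVELS FOR THE GENUINE `H = GQ*(QGQ*)⁻¹`, EVERY ODD `L ≥ 5`, `k ≥ 1`, NO PLACEMENT HYPOTHESIS** — the binders of
`B6Cor28EntriesKLevelV1.cor28_kLevel_H_DH` with `(2 ≤ k, P′ ≥ 5, all cubes placed)` replaced by `(1 ≤ k, k + 1 ≤ m + K, P′ = L·P″, P″ ≥ 5)` (pad by one empty level,
`placed_pad`; transport along `sameOm_domT_pad`): there are `σ₁ > 0` and, for every `σ ∈ (0, σ₁]`, `α ∈ (0, 1)`, constants `δ₅ > 0`, `C ≥ 0`, `M₂ > 0`, `N₁` such that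
for every such torus family, weights in the band, index bond `c`, fine bond `f`, direction `ν`:
`|(He_c)(f)| ≤ C·e^{−δ₅·d_T(y(f), β c)}` and `|(∇_νHe_c)(f)| ≤ C·(L^{j(y(f))}η)⁻¹·e^{−δ₅·d_T(y(f), β c)}`.
[cite: Balaban1984PropagatorsII, Cor. 2.8 (2.150)–(2.151) p.249, (2.1)–(2.4) p.224] -/
theorem cor28_kLevel_H_DH_pad (d ℓ : ℕ) (hd : 1 ≤ d + 1) (hL : Odd (ℓ + 1) ∧ 1 < ℓ + 1) {b₀ b₁ : ℝ} (hb₀ : 0 < b₀) (hb₁ : b₀ ≤ b₁) :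
    ∃ σ₁ : ℝ, 0 < σ₁ ∧ ∀ (σ : ℝ), 0 < σ → σ ≤ σ₁ → ∀ (α : ℝ), 0 < α → α < 1 →
    ∃ (δ₅ C M₂ : ℝ) (N₁ : ℕ), 0 < δ₅ ∧ 0 ≤ C ∧ 0 < M₂ ∧
    ∀ (m K : ℕ) {Mh k R : ℕ} {P' : Fin (d + 1) → ℕ}
      (hN : ∀ μ, N0 ℓ Mh k P' μ = (PV d ℓ m K hd hL).sitesPerDir 0) (D : TDomains d ℓ Mh k P' R) (hk : k ≤ m + K) (_ : 1 ≤ k) (_ : k + 1 ≤ m + K)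
      {P'' : Fin (d + 1) → ℕ} (_ : ∀ μ, P' μ = (ℓ + 1) * P'' μ) (_ : ∀ μ, 5 ≤ P'' μ)
      {a : ℕ} (_ : Mh = (ℓ + 1) ^ a) (_ : 8 ≤ Mh) (_ : 2 * (ℓ + 1) ^ 2 ≤ R) (_ : 4 ≤ ℓ)
      (_ : M₂ ≤ ((ℓ : ℝ) + 1) * Mh) (_ : N₁ + 1 ≤ R * ((ℓ + 1) * Mh))
      {cf : ℝ} (hcf : cf ≠ 0) {w : BondIdx (domT hN D hk) → ℝ} (hw : ∀ i, 0 < w i) (_ : GlobalBand b₀ b₁ cf w),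
      (∀ (c : BondIdx (domT hN D hk)) (f : PBond (PV d ℓ m K hd hL) 0),
        |(GE (domT hN D hk) hcf hw ∘ₗ QsE (domT hN D hk) ∘ₗ EE (domT hN D hk) hcf hw) (EuclideanSpace.single c (1 : ℝ)) f| ≤
          C * Real.exp (-(δ₅ * (geomT D).dist (blkV1 hN D f) (β hN D hk c)))) ∧
      (∀ (ν : Fin (d + 1)) (c : BondIdx (domT hN D hk)) (f : PBond (PV d ℓ m K hd hL) 0),
        |(DV ν cf ∘ₗ onFun (GE (domT hN D hk) hcf hw ∘ₗ QsE (domT hN D hk) ∘ₗ EE (domT hN D hk) hcf hw)) (Pi.single c 1) f| ≤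
          C * ((geomT D).len (blkV1 hN D f) * |cf|⁻¹)⁻¹ * Real.exp (-(δ₅ * (geomT D).dist (blkV1 hN D f) (β hN D hk c)))) := by
  obtain ⟨σ₁, hσ₁, h⟩ := cor28_kLevel_H_DH d ℓ hd hL hb₀ hb₁
  refine ⟨σ₁, hσ₁, fun σ hσ hσ1 α hα hα1 => ?_⟩
  obtain ⟨δ₅, C, M₂, N₁, hδ₅, hC, hM₂, hH⟩ := h σ hσ hσ1 α hα hα1
  refine ⟨δ₅, C, M₂, N₁, hδ₅, hC, hM₂, ?_⟩
  intro m K Mh k R P' hN D hk hk1 hk' P'' hLP hP5 a hMha hM8 hR2 hℓ hM hRM cf hcf w hw hwb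
  -- the padded family and the transport data
  have hS := sameOm_domT_pad hN D hk hLP hk'
  have hw' : ∀ i, 0 < (w ∘ hS.idxB) i := fun i => hw _
  obtain ⟨key1, key2⟩ := hH m K (hN_pad hN hLP) (padT D hLP) hk' (by omega) hMha hM8 hR2 hP5 hℓ (placed_pad D hLP hP5) hM hRM hcf hw'
    (globalBand_pad D hLP hN hk hk' hwb)
  constructor
  · intro c f
    have h1 := key1 (hS.idxB.symm c) f
    rw [UI_single hS c, H_UI hS hcf hw hw', ← eT_blkV1 D hLP hN, beta_pad hN D hk hLP hk' hk1 c, dist_eT] at h1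
    exact h1
  · intro ν c f
    have h2 := key2 ν (hS.idxB.symm c) f
    rw [LinearMap.comp_apply, onFun_H_single hS hcf hw hw' c, ← eT_blkV1 D hLP hN, beta_pad hN D hk hLP hk' hk1 c, dist_eT, len_eT D hLP] at h2
    rw [LinearMap.comp_apply]
    exact h2

end Main

end Summit.QuantumFields.YangMills.Theorems.FlatPortCor28Pad

end
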